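import Mathlib
import Summits.QuantumFields.YangMills.Theses.CovariantCurrentDoor
import Summits.QuantumFields.YangMills.Theorems.CovariantCurrentDoorCurrentStateOrthogonal
import Summits.QuantumFields.YangMills.Theorems.TransportFieldSmoothedFieldCovariance
import HarnessLib

/-!
# Item `CovariantCurrentDoor.CurrentStatePhysical` ⟨stmt-QuantumFields-23381⟩ — CLOSED: the covariant-current state `XΩ` is PHYSICAL and
# orthogonal to the vacuum

`currentStatePhysical_proof : Summit.QuantumFields.YangMills.Theses.CovariantCurrentDoor.CurrentStatePhysical`.  Assembly of the transport-field
regularity kit: `XΩ = Σ_x ∂_t|₀ Ω(U[(x,0) ↦ U_{(x,0)} expPauli(t b_{x+ê₀}(U))])` is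
* measurable and bounded — each summand is CONTINUOUS on the compact configuration space (`TransportField.continuous_deriv_vacuum_rightShift`,
  Feynman–Hellmann tranches 1–3b; continuity of the direction field `b`, stub file of ⟨23379⟩);
* gauge invariant — the smoothed field is covariant, `B(U^g)_s = g_s B(U)_s g_s⁻¹` (`smoothedField_gaugeTransform`), `𝔰𝔲(2)`-valued
  (`smoothedField_su2`), and Print's chart is `Ad`-equivariant in colour coordinates (`expPauli_colour_conj`), so the shifted configuration
  transforms as `(U^g)_t = (U_t)^g` (`update_gaugeTransform_conj`) and `Ω` is gauge invariant;
* zero-flux — `B(twist U) = B(U)` (`smoothedField_twist`) and `(twist U)_t = twist(U_t)` (`update_twist`), `Ω` is twist invariant;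
* orthogonal to `Ω` — `l2_current_vacuum_eq_zero` (file `CovariantCurrentDoorCurrentStateOrthogonal`).
HONEST FRAMING: a support item of LINE g17-B; the cruxes `CurrentCommutatorCeiling` / `CurrentNormFloor`, K2a and the YM mass gap are NOT proved.
No `sorry`, no new axiom, no new definition.  References: [cite: ReedSimonIV1978, Thm. XIII.43]; [cite: Balaban1985UV3, p. 260]; [cite: Luscher1983, §2].
-/

set_option autoImplicit false

noncomputable section

open MeasureTheory Filter Topology
open scoped BigOperators
open Literature.MathematicalPhysics.QuantumFieldTheory (GaugeConfig Site Edge gaugeTransform)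
open Literature.MathematicalPhysics.QuantumLattice (secondCountableTopology_su2)
open Literature.MathematicalPhysics.QuantumFieldTheory.Balaban1983to89.B10Eq18SigmaSU2 (pauli)
open Literature.MathematicalPhysics.QuantumFieldTheory.Balaban1983to89.B10Eq18SigmaSU2Haar (expPauli)
open Summit.QuantumFields.YangMills.Theorems.EquipartitionPinsProbe.TangentSteinFiniteBeta (exists_abs_le_of_continuous)

namespace Summit.QuantumFields.YangMills.Theorems.CovariantCurrentDoor

open Summit.QuantumFields.YangMills.Theorems.FemtoTransferGap
open Summit.QuantumFields.YangMills.Theorems.TransportField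

variable {L : ℕ} [NeZero L]

/-! ## §1 The shifted configuration transforms covariantly -/

omit [NeZero L] in
/-- `U^g[e ↦ (U^g)_e · h E h⁻¹] = (U[e ↦ U_e E])^g` with `h = g(x+ê₀)`, `e = (x,0)`. [folklore] -/
theorem update_gaugeTransform_conj (g : Site 3 L → SU2) (U : GaugeConfig 3 L SU2) (x : Site 3 L) (E : SU2) :
    Function.update (gaugeTransform g U) (x, (0 : Fin 3))
        (gaugeTransform g U (x, (0 : Fin 3)) * (g (x.shift 0) * E * (g (x.shift 0))⁻¹)) =
      gaugeTransform g (Function.update U (x, (0 : Fin 3)) (U (x, (0 : Fin 3)) * E)) := by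
  funext e
  by_cases he : e = (x, (0 : Fin 3))
  · subst he
    simp only [Function.update_self, gaugeTransform]
    group
  · simp only [Function.update_of_ne he, gaugeTransform]

omit [NeZero L] in
/-- `(twist U)[e ↦ (twist U)_e E] = twist (U[e ↦ U_e E])` (the twist multiplies links on the left). [folklore] -/
theorem update_twist (k : Fin 3) (z : SU2) (U : GaugeConfig 3 L SU2) (x : Site 3 L) (E : SU2) :
    Function.update (twist k z U) (x, (0 : Fin 3)) (twist k z U (x, (0 : Fin 3)) * E) =
      twist k z (Function.update U (x, (0 : Fin 3)) (U (x, (0 : Fin 3)) * E)) := by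
  funext e
  by_cases he : e = (x, (0 : Fin 3))
  · subst he
    simp only [Function.update_self, twist]
    split_ifs <;> simp [mul_assoc]
  · simp only [Function.update_of_ne he, twist]

/-! ## §2 The direction field transforms by `Ad`, and the one-link derivative of `Ω` is invariant -/

/-- **Gauge covariance of the current's direction**: `expPauli (t • b_s(U^g)) = g_s · expPauli (t • b_s(U)) · g_s⁻¹`. [cite: Balaban1985UV3, p. 260] -/
theorem expPauli_dir_gaugeTransform (n : ℕ) (g : Site 3 L → SU2) (U : GaugeConfig 3 L SU2) (s : Site 3 L) (t : ℝ) :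
    expPauli (t • ((EuclideanSpace.equiv (Fin 3) ℝ).symm fun a => (-(Complex.I / 2) * (pauli a * (((fun m : Site 3 L → Matrix (Fin 2) (Fin 2) ℂ => fun s : Site 3 L =>
          (1 / 5 : ℂ) • (m s + ∑ i ∈ ({1, 2} : Finset (Fin 3)),
            (su2Rep ((gaugeTransform g U) (s, i)) * m (s.shift i) * su2Rep ((gaugeTransform g U) (s, i))⁻¹ +
              su2Rep ((gaugeTransform g U) (s - Pi.single i 1, i))⁻¹ * m (s - Pi.single i 1) * su2Rep ((gaugeTransform g U) (s - Pi.single i 1, i))))))^[n] (fun s : Site 3 L =>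
          ((su2Rep (polyakovSite s (gaugeTransform g U) ((0 : Site 3 1), (1 : Fin 3)))).trace.re : ℂ) •
            ((1 / 2 : ℂ) • (su2Rep (polyakovSite s (gaugeTransform g U) ((0 : Site 3 1), (1 : Fin 3))) - su2Rep (polyakovSite s (gaugeTransform g U) ((0 : Site 3 1), (1 : Fin 3)))⁻¹))) s)).trace).re)) =
      g s * expPauli (t • ((EuclideanSpace.equiv (Fin 3) ℝ).symm fun a => (-(Complex.I / 2) * (pauli a * (((fun m : Site 3 L → Matrix (Fin 2) (Fin 2) ℂ => fun s : Site 3 L =>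
          (1 / 5 : ℂ) • (m s + ∑ i ∈ ({1, 2} : Finset (Fin 3)),
            (su2Rep (U (s, i)) * m (s.shift i) * su2Rep (U (s, i))⁻¹ +
              su2Rep (U (s - Pi.single i 1, i))⁻¹ * m (s - Pi.single i 1) * su2Rep (U (s - Pi.single i 1, i))))))^[n] (fun s : Site 3 L =>
          ((su2Rep (polyakovSite s U ((0 : Site 3 1), (1 : Fin 3)))).trace.re : ℂ) •
            ((1 / 2 : ℂ) • (su2Rep (polyakovSite s U ((0 : Site 3 1), (1 : Fin 3))) - su2Rep (polyakovSite s U ((0 : Site 3 1), (1 : Fin 3)))⁻¹))) s)).trace).re)) * (g s)⁻¹ := by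
  rw [smoothedField_gaugeTransform n g U]
  obtain ⟨hH, htr⟩ := smoothedField_su2 n U s
  exact expPauli_colour_conj (g s) _ hH htr t

/-- **Gauge invariance of each one-link derivative of the vacuum.** [cite: ReedSimonIV1978, Thm. XIII.43] -/
theorem deriv_current_gaugeTransform (β : ℝ) {Ω : GaugeConfig 3 L SU2 → ℝ} (hΩ : IsPhys Ω) (g : Site 3 L → SU2)
    (U : GaugeConfig 3 L SU2) (x : Site 3 L) :
    deriv (fun t : ℝ => Ω (Function.update (gaugeTransform g U) (x, (0 : Fin 3)) ((gaugeTransform g U) (x, (0 : Fin 3)) * expPauli (t • ((EuclideanSpace.equiv (Fin 3) ℝ).symm fun a => (-(Complex.I / 2) * (pauli a * (((fun m : Site 3 L → Matrix (Fin 2) (Fin 2) ℂ => fun s : Site 3 L =>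
          (1 / 5 : ℂ) • (m s + ∑ i ∈ ({1, 2} : Finset (Fin 3)),
            (su2Rep ((gaugeTransform g U) (s, i)) * m (s.shift i) * su2Rep ((gaugeTransform g U) (s, i))⁻¹ +
              su2Rep ((gaugeTransform g U) (s - Pi.single i 1, i))⁻¹ * m (s - Pi.single i 1) * su2Rep ((gaugeTransform g U) (s - Pi.single i 1, i))))))^[L ^ 2 * (⌈Real.log β⌉₊ + 1)] (fun s : Site 3 L =>
          ((su2Rep (polyakovSite s (gaugeTransform g U) ((0 : Site 3 1), (1 : Fin 3)))).trace.re : ℂ) •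
            ((1 / 2 : ℂ) • (su2Rep (polyakovSite s (gaugeTransform g U) ((0 : Site 3 1), (1 : Fin 3))) - su2Rep (polyakovSite s (gaugeTransform g U) ((0 : Site 3 1), (1 : Fin 3)))⁻¹))) ((x).shift 0))).trace).re))))) 0 =
      deriv (fun t : ℝ => Ω (Function.update U (x, (0 : Fin 3)) (U (x, (0 : Fin 3)) * expPauli (t • ((EuclideanSpace.equiv (Fin 3) ℝ).symm fun a => (-(Complex.I / 2) * (pauli a * (((fun m : Site 3 L → Matrix (Fin 2) (Fin 2) ℂ => fun s : Site 3 L =>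
          (1 / 5 : ℂ) • (m s + ∑ i ∈ ({1, 2} : Finset (Fin 3)),
            (su2Rep (U (s, i)) * m (s.shift i) * su2Rep (U (s, i))⁻¹ +
              su2Rep (U (s - Pi.single i 1, i))⁻¹ * m (s - Pi.single i 1) * su2Rep (U (s - Pi.single i 1, i))))))^[L ^ 2 * (⌈Real.log β⌉₊ + 1)] (fun s : Site 3 L =>
          ((su2Rep (polyakovSite s U ((0 : Site 3 1), (1 : Fin 3)))).trace.re : ℂ) •
            ((1 / 2 : ℂ) • (su2Rep (polyakovSite s U ((0 : Site 3 1), (1 : Fin 3))) - su2Rep (polyakovSite s U ((0 : Site 3 1), (1 : Fin 3)))⁻¹))) ((x).shift 0))).trace).re))))) 0 := by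
  congr 1
  funext t
  rw [expPauli_dir_gaugeTransform, update_gaugeTransform_conj, hΩ.gaugeInv]

/-- **Twist invariance of each one-link derivative of the vacuum.** [cite: ReedSimonIV1978, Thm. XIII.43] -/
theorem deriv_current_twist (β : ℝ) {Ω : GaugeConfig 3 L SU2 → ℝ} (hΩ : IsPhys Ω) (k : Fin 3) {z : SU2}
    (hz : z ∈ Subgroup.center SU2) (U : GaugeConfig 3 L SU2) (x : Site 3 L) :
    deriv (fun t : ℝ => Ω (Function.update (twist k z U) (x, (0 : Fin 3)) ((twist k z U) (x, (0 : Fin 3)) * expPauli (t • ((EuclideanSpace.equiv (Fin 3) ℝ).symm fun a => (-(Complex.I / 2) * (pauli a * (((fun m : Site 3 L → Matrix (Fin 2) (Fin 2) ℂ => fun s : Site 3 L =>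
          (1 / 5 : ℂ) • (m s + ∑ i ∈ ({1, 2} : Finset (Fin 3)),
            (su2Rep ((twist k z U) (s, i)) * m (s.shift i) * su2Rep ((twist k z U) (s, i))⁻¹ +
              su2Rep ((twist k z U) (s - Pi.single i 1, i))⁻¹ * m (s - Pi.single i 1) * su2Rep ((twist k z U) (s - Pi.single i 1, i))))))^[L ^ 2 * (⌈Real.log β⌉₊ + 1)] (fun s : Site 3 L =>
          ((su2Rep (polyakovSite s (twist k z U) ((0 : Site 3 1), (1 : Fin 3)))).trace.re : ℂ) •
            ((1 / 2 : ℂ) • (su2Rep (polyakovSite s (twist k z U) ((0 : Site 3 1), (1 : Fin 3))) - su2Rep (polyakovSite s (twist k z U) ((0 : Site 3 1), (1 : Fin 3)))⁻¹))) ((x).shift 0))).trace).re))))) 0 =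
      deriv (fun t : ℝ => Ω (Function.update U (x, (0 : Fin 3)) (U (x, (0 : Fin 3)) * expPauli (t • ((EuclideanSpace.equiv (Fin 3) ℝ).symm fun a => (-(Complex.I / 2) * (pauli a * (((fun m : Site 3 L → Matrix (Fin 2) (Fin 2) ℂ => fun s : Site 3 L =>
          (1 / 5 : ℂ) • (m s + ∑ i ∈ ({1, 2} : Finset (Fin 3)),
            (su2Rep (U (s, i)) * m (s.shift i) * su2Rep (U (s, i))⁻¹ +
              su2Rep (U (s - Pi.single i 1, i))⁻¹ * m (s - Pi.single i 1) * su2Rep (U (s - Pi.single i 1, i))))))^[L ^ 2 * (⌈Real.log β⌉₊ + 1)] (fun s : Site 3 L =>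
          ((su2Rep (polyakovSite s U ((0 : Site 3 1), (1 : Fin 3)))).trace.re : ℂ) •
            ((1 / 2 : ℂ) • (su2Rep (polyakovSite s U ((0 : Site 3 1), (1 : Fin 3))) - su2Rep (polyakovSite s U ((0 : Site 3 1), (1 : Fin 3)))⁻¹))) ((x).shift 0))).trace).re))))) 0 := by
  rw [smoothedField_twist _ k hz U]
  congr 1
  funext t
  rw [update_twist, hΩ.zeroFlux k z hz]

/-! ## §3 `XΩ` is physical -/

/-- ★ **`XΩ` is a physical zero-flux test function** (measurable, bounded, gauge invariant, twist invariant). [cite: ReedSimonIV1978, Thm. XIII.43] -/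
theorem isPhys_current (β : ℝ) {Ω : GaugeConfig 3 L SU2 → ℝ} (hΩ : IsPhys Ω) (heig : transferApply β Ω = topValue su2Rep L β • Ω) :
    IsPhys (fun U : GaugeConfig 3 L SU2 => (∑ x : Site 3 L, deriv (fun t : ℝ => Ω (Function.update U (x, (0 : Fin 3)) (U (x, (0 : Fin 3)) * expPauli (t • ((EuclideanSpace.equiv (Fin 3) ℝ).symm fun a => (-(Complex.I / 2) * (pauli a * (((fun m : Site 3 L → Matrix (Fin 2) (Fin 2) ℂ => fun s : Site 3 L =>
          (1 / 5 : ℂ) • (m s + ∑ i ∈ ({1, 2} : Finset (Fin 3)),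
            (su2Rep (U (s, i)) * m (s.shift i) * su2Rep (U (s, i))⁻¹ +
              su2Rep (U (s - Pi.single i 1, i))⁻¹ * m (s - Pi.single i 1) * su2Rep (U (s - Pi.single i 1, i))))))^[L ^ 2 * (⌈Real.log β⌉₊ + 1)] (fun s : Site 3 L =>
          ((su2Rep (polyakovSite s U ((0 : Site 3 1), (1 : Fin 3)))).trace.re : ℂ) •
            ((1 / 2 : ℂ) • (su2Rep (polyakovSite s U ((0 : Site 3 1), (1 : Fin 3))) - su2Rep (polyakovSite s U ((0 : Site 3 1), (1 : Fin 3)))⁻¹))) ((x).shift 0))).trace).re))))) 0)) := by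
  haveI : SecondCountableTopology SU2 := secondCountableTopology_su2
  have hB := continuous_smoothedField (L := L) (L ^ 2 * (⌈Real.log β⌉₊ + 1))
  have hdir : ∀ x : Site 3 L, Continuous fun U : GaugeConfig 3 L SU2 => ((EuclideanSpace.equiv (Fin 3) ℝ).symm fun a => (-(Complex.I / 2) * (pauli a * (((fun m : Site 3 L → Matrix (Fin 2) (Fin 2) ℂ => fun s : Site 3 L =>
          (1 / 5 : ℂ) • (m s + ∑ i ∈ ({1, 2} : Finset (Fin 3)),
            (su2Rep (U (s, i)) * m (s.shift i) * su2Rep (U (s, i))⁻¹ +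
              su2Rep (U (s - Pi.single i 1, i))⁻¹ * m (s - Pi.single i 1) * su2Rep (U (s - Pi.single i 1, i))))))^[L ^ 2 * (⌈Real.log β⌉₊ + 1)] (fun s : Site 3 L =>
          ((su2Rep (polyakovSite s U ((0 : Site 3 1), (1 : Fin 3)))).trace.re : ℂ) •
            ((1 / 2 : ℂ) • (su2Rep (polyakovSite s U ((0 : Site 3 1), (1 : Fin 3))) - su2Rep (polyakovSite s U ((0 : Site 3 1), (1 : Fin 3)))⁻¹))) ((x).shift 0))).trace).re) :=
    fun x => continuous_colourOf ((continuous_apply (x.shift 0)).comp hB)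
  have hcont : Continuous fun U : GaugeConfig 3 L SU2 => (∑ x : Site 3 L, deriv (fun t : ℝ => Ω (Function.update U (x, (0 : Fin 3)) (U (x, (0 : Fin 3)) * expPauli (t • ((EuclideanSpace.equiv (Fin 3) ℝ).symm fun a => (-(Complex.I / 2) * (pauli a * (((fun m : Site 3 L → Matrix (Fin 2) (Fin 2) ℂ => fun s : Site 3 L =>
          (1 / 5 : ℂ) • (m s + ∑ i ∈ ({1, 2} : Finset (Fin 3)),
            (su2Rep (U (s, i)) * m (s.shift i) * su2Rep (U (s, i))⁻¹ +
              su2Rep (U (s - Pi.single i 1, i))⁻¹ * m (s - Pi.single i 1) * su2Rep (U (s - Pi.single i 1, i))))))^[L ^ 2 * (⌈Real.log β⌉₊ + 1)] (fun s : Site 3 L =>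
          ((su2Rep (polyakovSite s U ((0 : Site 3 1), (1 : Fin 3)))).trace.re : ℂ) •
            ((1 / 2 : ℂ) • (su2Rep (polyakovSite s U ((0 : Site 3 1), (1 : Fin 3))) - su2Rep (polyakovSite s U ((0 : Site 3 1), (1 : Fin 3)))⁻¹))) ((x).shift 0))).trace).re))))) 0) :=
    continuous_finsetSum _ fun x _ => continuous_deriv_vacuum_rightShift β (x, (0 : Fin 3)) (hdir x) hΩ heig
  obtain ⟨C, -, hC⟩ := exists_abs_le_of_continuous hcont
  exact
    { measurable := hcont.measurable
      bounded := ⟨C, hC⟩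
      gaugeInv := fun g U => Finset.sum_congr rfl fun x _ => deriv_current_gaugeTransform β hΩ g U x
      zeroFlux := fun k z hz U => Finset.sum_congr rfl fun x _ => deriv_current_twist β hΩ k hz U x }

/-! ## §4 The item -/

/-- ★★★ **`CovariantCurrentDoor.CurrentStatePhysical`** ⟨stmt-QuantumFields-23381⟩: for `β > 0`, every `L` and every normalised physical
vacuum `Ω`, the covariant-current state `XΩ` is physical and `⟨XΩ, Ω⟩ = 0`. [cite: ReedSimonIV1978, Thm. XIII.43] [cite: Balaban1985UV3, p. 260] -/
theorem currentStatePhysical_proof : Summit.QuantumFields.YangMills.Theses.CovariantCurrentDoor.CurrentStatePhysical := by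
  intro β hβ L _ Ω hΩ hn heig
  have horth := l2_current_vacuum_eq_zero β hβ L Ω hΩ hn heig
  dsimp only at horth ⊢
  exact ⟨isPhys_current β hΩ heig, horth⟩

end Summit.QuantumFields.YangMills.Theorems.CovariantCurrentDoor

end
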